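import Summits.BirchSwinnertonDyer.BirchSwinnertonDyer.Theorems.EisensteinPrimesXAcImprimitiveNoPTorsion
import Summits.BirchSwinnertonDyer.BirchSwinnertonDyer.Theorems.EisensteinPrimesKellerYinLemma511OfCharacterResidualFiniteness
import Summits.BirchSwinnertonDyer.BirchSwinnertonDyer.Theorems.UniversalToricDescentAcDualMuZeroCriterion
import Literature.NumberTheory.EllipticCurves.KellerYin2024.CharacterResidualUnrSelmerFinite
import HarnessLib

/-!
# (N1)^{Sf} AT BOTH SIGNS: `𝔛^{Sf}_f` has no `p`-torsion as soon as `Sel^{Sf}_{v̄}(K_∞, E_K[p^∞])[p]` is finite (any reduction type),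
# hence at EVERY multiplicative Eisenstein prime modulo Greenberg's published facts + Keller–Yin Prop. 1.2.5's finiteness clause
# (cell `bsd-eis`, width seat `bsd-line-x2-p2` gen 7; crux 4 `BSDpOnCellC` stmt-BirchSwinnertonDyer-19034, line b1 v12; corollaries of p654300)

HONEST FRAMING (cell `bsd-eis`, run/shared/lean/pub/bsd-eis/): bookkeeping; no definition, no named fact introduced, no `sorry`, no
`Theses` import; nothing about BSD or a main conjecture is asserted; nothing booked; no label or count moves. Helper `--supports
stmt-BirchSwinnertonDyer-19034`; closes no stub. CONDITIONAL BY NAME on Greenberg 2016 Prop. 4.1.1 + Greenberg 2006 Props. 4.1, 4.2,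
3.2 [PUB]; §2 moreover on the PREPRINT claim `KellerYin2024.prop125_residualCharacterUnrSelmer_finite_OPEN` (Keller–Yin
arXiv:2402.12781v2 Prop. 1.2.5, finiteness clause, arbitrary `θ` — `[claim: KellerYin2024, status: under-review]`).

## What

p654300 (`XAcImprimitiveNoPTorsion.xAc_smul_eq_zero_imp_of_facts`) is reduction-type-free but asks for `𝔛^{Sf}_f` finitely generated,
`Λ`-torsion, `μ = 0`; its §2–§3 supply these at a NON-SPLIT multiplicative prime from CGLS22 Prop. 14 [PUB]. At a SPLIT multiplicative
prime both residual characters at `v̄` lie in `{𝟙, ω}` and CGLS's hypothesis fails; Keller–Yin Prop. 1.2.5 removes it (preprint). Here: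

* §1 **`xAc_smul_eq_zero_imp_of_facts_of_pTorsion_finite`** — ANY reduction type at `p`: if `{s ∈ Sel^{Sf}_{v̄}(K_∞, E_K[p^∞]) : p s = 0}`
  is finite then `𝔛^{Sf}_f` has no `p`-torsion (finite generation is Castella's `XAc.module_finite`; torsion and `μ = 0` are cell
  `bsd-wall`'s `UniversalToricDescentAcDualMuZero.isTorsion/muInvariant_eq_zero_of_finite_pTorsion`; then p654300 §1).
* §2 **`xAc_smul_eq_zero_imp_of_facts_of_prop125_OPEN`** — at EVERY Eisenstein datum of Keller–Yin Lemma 5.1.1 (`Red`, split OR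
  non-split `p ‖ N`, indeed any `p` with `E[p]` reducible), the preprint finiteness clause ⟹ `Sel[p]` finite (g4's
  `residualFinite_of_unrCharacterFinite`, p628626 dévissage without the non-anomalous clause) ⟹ (N1)^{Sf}. This is the E-level input
  «no finite `Λ`-submodule» of Keller–Yin Thm. 1.4.1 / §5.1 Cases I–III at the SPLIT sign too (the λ-identity with error terms there
  is g5's, untouched).

References: [Greenberg2016Selmer] Prop. 4.1.1 (c); [Greenberg2006] Props. 3.2, 4.1, 4.2; [KellerYin2024] Prop. 1.2.5, Thm. 1.4.1, §1.4 (e),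
Lemma 5.1.1, §5.1 (arXiv:2402.12781v2); [CastellaGrossiLeeSkinner2022] Cor. 1.4.3; [Castella2018] Def. 2.2; [GreenbergLNM1716] §1 p. 60.
-/

set_option autoImplicit false
set_option linter.dupNamespace false -- the summit namespace `…BirchSwinnertonDyer.BirchSwinnertonDyer.Theorems` (Sub = Summit, D-0017) trips it

noncomputable section

open scoped Classical
open NumberField IsDedekindDomain Field WeierstrassCurve
open Literature.NumberTheory.EllipticCurves Literature.NumberTheory.EllipticCurves.GreenbergSelmer
  Literature.NumberTheory.GaloisRepresentations Literature.NumberTheory.EllipticCurves.KellerYin2024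
  Literature.NumberTheory.EllipticCurves.Castella2018.AcSelmer Literature.NumberTheory.EllipticCurves.Rank1Residual
  Literature.NumberTheory.IwasawaTheory Literature.NumberTheory.IwasawaTheory.Greenberg2016
  Literature.NumberTheory.IwasawaTheory.Greenberg2006
  Summit.BirchSwinnertonDyer.BirchSwinnertonDyer.Theorems

namespace Summit.BirchSwinnertonDyer.BirchSwinnertonDyer.Theorems.XAcImprimitiveNoPTorsion

variable {K : Type} [Field K] [NumberField K] {p : ℕ} [Fact p.Prime]

/-! ## §1 Any reduction type: `Sel[p]` finite ⟹ no `p`-torsion in `𝔛^{Sf}_f` -/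

/-- **(N1)^{Sf} from the finiteness of `Sel^{Sf}_{v̄}(K_∞, E_K[p^∞])[p]`, ANY reduction type at `p`.** Binders of p654300 §1 (`E = W/ℚ`
over the imaginary quadratic `K` with (Heeg) for `N_E`, `2 < p = v v̄`, `κ` anticyclotomic with generator `γ`, `Sf` the places over `N_E`
off `p`); hypotheses: Greenberg 2016 Prop. 4.1.1 + Greenberg 2006 Props. 4.1, 4.2, 3.2 BY NAME and `{s : p • s = 0}` finite. Then
`∀ x : 𝔛^{Sf}_f, p • x = 0 → x = 0`. [cite: Greenberg2016Selmer, Prop. 4.1.1 (c) (§4.1 p. 15 L21–32)] [cite: Greenberg2006, Props. 3.2, 4.1, 4.2]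
[cite: GreenbergLNM1716, §1 p. 60 (X/𝔪X finite ⟹ structure)] [cite: CastellaGrossiLeeSkinner2022, Cor. 1.4.3] -/
theorem xAc_smul_eq_zero_imp_of_facts_of_pTorsion_finite (h411 : prop411_selmer_isAlmostDivisible)
    (h41 : prop41_globalEulerPoincareCorank) (h42 : prop42_localEulerPoincareCorank)
    (h32 : prop32_cohomology_isCofinitelyGenerated)
    (W : WeierstrassCurve ℚ) [W.IsElliptic] (hp : 2 < p) (hK : IsImaginaryQuadratic K)
    (hH : SatisfiesHeegnerHypothesis (W.conductorNorm ℤ) K)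
    {v vbar : HeightOneSpectrum (𝓞 K)} (hv : ((p : ℕ) : 𝓞 K) ∈ v.asIdeal)
    (hvbar : ((p : ℕ) : 𝓞 K) ∈ vbar.asIdeal) (hne : vbar ≠ v)
    (κ : ZpExtension K p) (hκ : κ.IsAnticyclotomic) (γ : absoluteGaloisGroup K) [Fact (κ.IsTopGenerator γ)]
    (Sf : Finset (HeightOneSpectrum (𝓞 K)))
    (hSf : ∀ w : HeightOneSpectrum (𝓞 K), w ∈ Sf ↔
      (((W.conductorNorm ℤ : ℤ) : 𝓞 K) ∈ w.asIdeal ∧ ((p : ℕ) : 𝓞 K) ∉ w.asIdeal))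
    (hfin : Set.Finite {s : selmerAc (W.baseChange K) p κ vbar (↑Sf : Set (HeightOneSpectrum (𝓞 K))) | p • s = 0})
    (x : XAc (W.baseChange K) p κ vbar (↑Sf : Set (HeightOneSpectrum (𝓞 K))) γ) (hx : p • x = 0) : x = 0 := by
  haveI hEK : (W.baseChange K).IsElliptic := inferInstanceAs (W.map (algebraMap ℚ K)).IsElliptic
  have hS : (↑Sf : Set (HeightOneSpectrum (𝓞 K))).Finite := Finset.finite_toSet Sf
  exact xAc_smul_eq_zero_imp_of_facts h411 h41 h42 h32 W hp hK hH hv hvbar hne κ hκ γ Sf hSf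
    (XAc.module_finite (W.baseChange K) p κ vbar _ γ hS)
    (UniversalToricDescentAcDualMuZero.isTorsion_of_finite_pTorsion (W.baseChange K) p κ vbar _ γ hS hfin)
    (UniversalToricDescentAcDualMuZero.muInvariant_eq_zero_of_finite_pTorsion (W.baseChange K) p κ vbar _ γ hS hfin) x hx

/-! ## §2 Every reducible `p` (both multiplicative signs), modulo Keller–Yin Prop. 1.2.5's finiteness clause (preprint) -/

/-- **(N1)^{Sf} at EVERY Eisenstein datum with `E[p]` reducible — in particular at a SPLIT multiplicative `p ‖ N` — modulo Greenberg's
published facts and Keller–Yin Prop. 1.2.5's finiteness clause for characters (PREPRINT named fact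
`KellerYin2024.prop125_residualCharacterUnrSelmer_finite_OPEN`).** Binders: `W/ℚ` globally minimal, `2 < p = v v̄` split in the imaginary
quadratic `K` with (Heeg) for `N_E`, `E[p]` reducible (`Red`), `κ` anticyclotomic with generator `γ`, `Sf` the places over `N_E` off `p`.
`Sel[p]` finite by g4's `residualFinite_of_unrCharacterFinite` (both signs), then §1. CONDITIONAL on an unrefereed claim (`hfact`).
[claim: KellerYin2024, status: under-review] [cite: KellerYin2024, Prop. 1.2.5, §1.4 (e), Lemma 5.1.1, §5.1 Cases I–III (arXiv:2402.12781v2)]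
[cite: Greenberg2016Selmer, Prop. 4.1.1 (c)] [cite: Greenberg2006, Props. 3.2, 4.1, 4.2] -/
theorem xAc_smul_eq_zero_imp_of_facts_of_prop125_OPEN (h411 : prop411_selmer_isAlmostDivisible)
    (h41 : prop41_globalEulerPoincareCorank) (h42 : prop42_localEulerPoincareCorank)
    (h32 : prop32_cohomology_isCofinitelyGenerated)
    (hfact : prop125_residualCharacterUnrSelmer_finite_OPEN)
    (W : WeierstrassCurve ℚ) [W.IsElliptic] [W.IsGloballyMinimal] (hp : 2 < p) (hred : Red W p)
    (hK : IsImaginaryQuadratic K) (hH : SatisfiesHeegnerHypothesis (W.conductorNorm ℤ) K)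
    (hsplit : ((Ideal.span {(p : ℤ)}).primesOver (𝓞 K)).ncard = 2)
    {v vbar : HeightOneSpectrum (𝓞 K)} (hv : ((p : ℕ) : 𝓞 K) ∈ v.asIdeal)
    (hvbar : ((p : ℕ) : 𝓞 K) ∈ vbar.asIdeal) (hne : vbar ≠ v)
    (κ : ZpExtension K p) (hκ : κ.IsAnticyclotomic) (γ : absoluteGaloisGroup K) [Fact (κ.IsTopGenerator γ)]
    (Sf : Finset (HeightOneSpectrum (𝓞 K)))
    (hSf : ∀ w : HeightOneSpectrum (𝓞 K), w ∈ Sf ↔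
      (((W.conductorNorm ℤ : ℤ) : 𝓞 K) ∈ w.asIdeal ∧ ((p : ℕ) : 𝓞 K) ∉ w.asIdeal))
    (x : XAc (W.baseChange K) p κ vbar (↑Sf : Set (HeightOneSpectrum (𝓞 K))) γ) (hx : p • x = 0) : x = 0 :=
  xAc_smul_eq_zero_imp_of_facts_of_pTorsion_finite h411 h41 h42 h32 W hp hK hH hv hvbar hne κ hκ γ Sf hSf
    (KellerYinLemma511OfCharacterResidualFiniteness.residualFinite_of_unrCharacterFinite hfact W K vbar κ Sf hp hred hK hH
      hsplit hvbar hκ hSf) x hx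

end Summit.BirchSwinnertonDyer.BirchSwinnertonDyer.Theorems.XAcImprimitiveNoPTorsion

end
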